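import Mathlib
import Summits.CriticalPhenomena.CardyFormulaZ2.Theorems.CardySelfRefinementGradientComparabilityStubDcEqSumPivotal
import HarnessLib

/-!
# Slope bounds, Stage A (combinatorial part): a pivotal selector forces a pivotal sub-edge

Crux `stmt-CriticalPhenomena-10269`
(`Summit.CriticalPhenomena.CardyFormulaZ2.Theses.CardySelfRefinement.GradientComparability`),
line `monotone-product-coordinates`, helper file of the stub `stub_slopeBounds` (first-order slope
bounds `|∂ρP| ≤ C ∂cP` in the bulk).  Vocabulary (`ax tb opn cfg Aloc edgeOf`) from
`CardySelfRefinementDefs`.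

## Mathematics

Fix `k ≥ 1`, a coarse base `t ∈ ℤ²` and a direction `d`.  The **bundle** `(t, d)` consists of the
`k` axial fine edges `(w j, d)`, `w j = k•t + j e_d` (`j < k`), i.e. exactly the axial labels
`(v, d)` with `tb k (v, d) = t` (`exists_bundle_param`); they are the only edges whose read-out
involves the selector `(t, d, 2)`, the shared coin `(t, d, 1)` or the own coins `(w j, d, 0)`
(`opn_congr_off_bundle`, `cfg_congr_bundle`).  For a coin sample `S` and `J ⊆ {own coins}` let
`S_J = (S ∖ T) ∪ J`, `T = {selector} ∪ {own coins}` (selector off, own coins reset to `J`); then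
`J ↦ cfg k S_J` is increasing, `cfg k (S ∖ {selector}) = cfg k S_{J(S)}` and
`cfg k (S ∪ {selector}) = cfg k S_{all}` or `cfg k S_∅` according to the shared coin.  Hence if the
selector is pivotal for the pulled-back (increasing) crossing event `E = cfg k ⁻¹' Aloc`, then
`S_∅ ∉ E`, `S_{all} ∈ E`, and along the chain `J_0 = ∅ ⊂ J_1 ⊂ ⋯ ⊂ J_k = all` some own coin
`(w j, d, 0)` is pivotal for `E` at `S_{J_j}` (`exists_isPivotal_own_of_isPivotal_selector`, the
registered sub-goal).  With the selector off, pivotality of an own coin is pivotality of its edge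
(`isPivotal_own_iff_of_selector_notMem`).  The probabilistic charging and the bound on `|∂ρP|`
are in the companion file `…StubSlopeBoundsStageA`.
-/

noncomputable section

namespace Summit.CriticalPhenomena.CardyFormulaZ2.Theorems.CardySelfRefinement

open scoped Topology
open Filter Set MeasureTheory
open Literature.Probability.LatticeModels Literature.Probability.Percolation
open Literature.Probability.Percolation.QuadCrossing
open Summit.CriticalPhenomena.CardyFormulaZ2.Theses.CardySelfRefinement

/-! ## The bundle of a coarse edge: its `k` sub-edges -/

/-- **Parametrisation of a bundle.** For `0 < k`, a coarse base `t` and a direction `d` there is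
an injective enumeration `w 0, …, w (k-1)` (namely `w j = k•t + j e_d`) of the base vertices of the
sub-edges of the bundle `(t, d)`: every `(w j, d)` is axial with coarse base `t`, and every axial
`(v, d)` with coarse base `t` is one of them. -/
theorem exists_bundle_param {k : ℕ} (hk : 0 < k) (t : Site 2) (d : Fin 2) :
    ∃ w : ℕ → Site 2,
      (∀ j, j < k → ax k (w j, d) ∧ tb k (w j, d) = t) ∧
      (∀ v : Site 2, ax k (v, d) → tb k (v, d) = t → ∃ j, j < k ∧ v = w j) ∧
      (∀ j j', j < k → j' < k → w j = w j' → j = j') := by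
  have hk0 : (k : ℤ) ≠ 0 := by exact_mod_cast hk.ne'
  have hkpos : (0 : ℤ) < k := by exact_mod_cast hk
  have hperp : (if d = 0 then (1 : Fin 2) else 0) ≠ d := by
    fin_cases d <;> decide
  refine ⟨fun j l => (k : ℤ) * t l + if l = d then (j : ℤ) else 0, ?_, ?_, ?_⟩
  · intro j hj
    refine ⟨?_, ?_⟩
    · show (k : ℤ) ∣ (k : ℤ) * t _ + if (if d = 0 then (1 : Fin 2) else 0) = d then (j : ℤ) else 0
      rw [if_neg hperp, add_zero]
      exact dvd_mul_right _ _
    · funext l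
      show ((k : ℤ) * t l + if l = d then (j : ℤ) else 0) / (k : ℤ) = t l
      split_ifs
      · rw [add_comm, Int.add_mul_ediv_left _ _ hk0,
          Int.ediv_eq_zero_of_lt (by positivity) (by exact_mod_cast hj), zero_add]
      · rw [add_zero, Int.mul_ediv_cancel_left _ hk0]
  · intro v hax htb
    have hax' : (k : ℤ) ∣ v (if d = 0 then (1 : Fin 2) else 0) := hax
    have htl : ∀ l, t l = v l / k := fun l => (congrFun htb l).symm
    have h0 : 0 ≤ v d % k := Int.emod_nonneg _ hk0
    have h1 : v d % k < k := Int.emod_lt_of_pos _ hkpos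
    refine ⟨(v d % k).toNat, by omega, ?_⟩
    funext l
    show v l = (k : ℤ) * t l + if l = d then (((v d % k).toNat : ℕ) : ℤ) else 0
    by_cases hl : l = d
    · subst hl
      rw [if_pos rfl, Int.toNat_of_nonneg h0, htl]
      exact (Int.mul_ediv_add_emod _ _).symm
    · have hl' : l = (if d = 0 then (1 : Fin 2) else 0) := by
        fin_cases d <;> fin_cases l <;> simp_all
      rw [if_neg hl, add_zero, htl, hl']
      exact (Int.mul_ediv_cancel' hax').symm
  · intro j j' _ _ h
    simpa using congrFun h d

/-- Read-out of a sub-edge `(w j, d)` of the bundle `(t, d)`: (selector on and shared coin on) or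
(selector off and own coin on). -/
theorem opn_subEdge (k : ℕ) {t : Site 2} {d : Fin 2} {w : ℕ → Site 2} {j : ℕ}
    (hj : ax k (w j, d) ∧ tb k (w j, d) = t) (S : Set (Site 2 × Fin 2 × Fin 3)) :
    opn k S (w j, d) ↔ ((t, d, (2 : Fin 3)) ∈ S ∧ (t, d, (1 : Fin 3)) ∈ S) ∨
      ((t, d, (2 : Fin 3)) ∉ S ∧ (w j, d, (0 : Fin 3)) ∈ S) := by
  show (if ax k (w j, d) then _ else _) ↔ _
  rw [if_pos hj.1, hj.2]

/-- An edge outside the bundle `(t, d)` does not read the selector `(t, d, 2)` nor the own coins of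
the sub-edges: two coin samples agreeing off these coins give it the same read-out. -/
theorem opn_congr_off_bundle (k : ℕ) {t : Site 2} {d : Fin 2} {w : ℕ → Site 2}
    (hw₂ : ∀ v : Site 2, ax k (v, d) → tb k (v, d) = t → ∃ j, j < k ∧ v = w j)
    {S₁ S₂ : Set (Site 2 × Fin 2 × Fin 3)}
    (h : ∀ x : Site 2 × Fin 2 × Fin 3, x ≠ (t, d, (2 : Fin 3)) →
      (∀ j, j < k → x ≠ (w j, d, (0 : Fin 3))) → (x ∈ S₁ ↔ x ∈ S₂))
    {vd : Site 2 × Fin 2} (hvd : ∀ j, j < k → vd ≠ (w j, d)) :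
    opn k S₁ vd ↔ opn k S₂ vd := by
  obtain ⟨v, d'⟩ := vd
  have h0 : (v, d', (0 : Fin 3)) ∈ S₁ ↔ (v, d', (0 : Fin 3)) ∈ S₂ := by
    refine h _ (by simp) fun j hj hx => hvd j hj ?_
    simp only [Prod.mk.injEq] at hx ⊢
    exact ⟨hx.1, hx.2.1⟩
  by_cases hax : ax k (v, d')
  · have hne : (tb k (v, d'), d') ≠ (t, d) := by
      intro heq
      rw [Prod.mk.injEq] at heq
      obtain ⟨htb, rfl⟩ := heq
      obtain ⟨j, hj, rfl⟩ := hw₂ v hax htb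
      exact hvd j hj rfl
    have h1 : (tb k (v, d'), d', (1 : Fin 3)) ∈ S₁ ↔ (tb k (v, d'), d', (1 : Fin 3)) ∈ S₂ :=
      h _ (by simp) fun j _ hx => by simp at hx
    have h2 : (tb k (v, d'), d', (2 : Fin 3)) ∈ S₁ ↔ (tb k (v, d'), d', (2 : Fin 3)) ∈ S₂ := by
      refine h _ (fun hx => hne ?_) fun j _ hx => by simp at hx
      simp only [Prod.mk.injEq] at hx ⊢
      exact ⟨hx.1, hx.2.1⟩
    simp only [opn, if_pos hax, h0, h1, h2]
  · simp only [opn, if_neg hax, h0]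

/-- **Bundle surgery.** Two coin samples which agree off the selector and the own coins of the
bundle `(t, d)`, and give every sub-edge the same read-out, have the same configuration. -/
theorem cfg_congr_bundle (k : ℕ) {t : Site 2} {d : Fin 2} {w : ℕ → Site 2}
    (hw₂ : ∀ v : Site 2, ax k (v, d) → tb k (v, d) = t → ∃ j, j < k ∧ v = w j)
    {S₁ S₂ : Set (Site 2 × Fin 2 × Fin 3)}
    (h : ∀ x : Site 2 × Fin 2 × Fin 3, x ≠ (t, d, (2 : Fin 3)) →
      (∀ j, j < k → x ≠ (w j, d, (0 : Fin 3))) → (x ∈ S₁ ↔ x ∈ S₂))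
    (hb : ∀ j, j < k → (opn k S₁ (w j, d) ↔ opn k S₂ (w j, d))) :
    cfg k S₁ = cfg k S₂ := by
  have key : ∀ vd, opn k S₁ vd ↔ opn k S₂ vd := by
    intro vd
    by_cases hvd : ∃ j, j < k ∧ vd = (w j, d)
    · obtain ⟨j, hj, rfl⟩ := hvd
      exact hb j hj
    · push Not at hvd
      exact opn_congr_off_bundle k hw₂ h hvd
  ext e
  constructor
  · rintro ⟨v, d', rfl, hopn⟩
    exact ⟨v, d', rfl, (key (v, d')).1 hopn⟩
  · rintro ⟨v, d', rfl, hopn⟩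
    exact ⟨v, d', rfl, (key (v, d')).2 hopn⟩

/-! ## Own-coin surgery when the selector is off -/

/-- When the selector of its bundle is off (vacuous for an interior edge), switching the own coin
of the edge `(v, d)` on switches exactly the edge `edgeOf (v, d)` on. -/
theorem cfg_insert_own_of_selector_notMem (k : ℕ) (S : Set (Site 2 × Fin 2 × Fin 3)) {v : Site 2}
    {d : Fin 2} (hsel : (tb k (v, d), d, (2 : Fin 3)) ∉ S) :
    cfg k (insert (v, d, (0 : Fin 3)) S) = insert (edgeOf (v, d)) (cfg k S) := by
  have hoff : ∀ vd : Site 2 × Fin 2, vd ≠ (v, d) →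
      (opn k (insert (v, d, (0 : Fin 3)) S) vd ↔ opn k S vd) := fun vd hvd =>
    opn_congr_of_ne_own k (fun i hi => by simp only [Set.mem_insert_iff, hi, false_or]) hvd
  have hon : opn k (insert (v, d, (0 : Fin 3)) S) (v, d) := by
    by_cases hax : ax k (v, d)
    · have hsel' : (tb k (v, d), d, (2 : Fin 3)) ∉ insert (v, d, (0 : Fin 3)) S := by
        simp only [Set.mem_insert_iff, not_or]
        exact ⟨by simp, hsel⟩
      simp only [opn, if_pos hax]
      exact Or.inr ⟨hsel', Set.mem_insert _ _⟩
    · simp only [opn, if_neg hax]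
      exact Set.mem_insert _ _
  ext e
  constructor
  · rintro ⟨v', d', rfl, hopn⟩
    by_cases hvd : (v', d') = (v, d)
    · rw [Prod.mk.injEq] at hvd
      obtain ⟨rfl, rfl⟩ := hvd
      exact Set.mem_insert _ _
    · exact Set.mem_insert_of_mem _ ⟨v', d', rfl, (hoff (v', d') hvd).1 hopn⟩
  · rintro (rfl | ⟨v', d', rfl, hopn⟩)
    · exact ⟨v, d, rfl, hon⟩
    · by_cases hvd : (v', d') = (v, d)
      · rw [Prod.mk.injEq] at hvd
        obtain ⟨rfl, rfl⟩ := hvd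
        exact ⟨_, _, rfl, hon⟩
      · exact ⟨v', d', rfl, (hoff (v', d') hvd).2 hopn⟩

/-- When the selector of its bundle is off (vacuous for an interior edge), switching the own coin
of the edge `(v, d)` off switches exactly the edge `edgeOf (v, d)` off. -/
theorem cfg_sdiff_own_of_selector_notMem (k : ℕ) (S : Set (Site 2 × Fin 2 × Fin 3)) {v : Site 2}
    {d : Fin 2} (hsel : (tb k (v, d), d, (2 : Fin 3)) ∉ S) :
    cfg k (S \ {(v, d, (0 : Fin 3))}) = cfg k S \ {edgeOf (v, d)} := by
  have hoff : ∀ vd : Site 2 × Fin 2, vd ≠ (v, d) →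
      (opn k (S \ {(v, d, (0 : Fin 3))}) vd ↔ opn k S vd) := fun vd hvd =>
    opn_congr_of_ne_own k
      (fun i hi => by simp only [Set.mem_sdiff, Set.mem_singleton_iff, hi, not_false_eq_true, and_true])
      hvd
  have hoff' : ¬ opn k (S \ {(v, d, (0 : Fin 3))}) (v, d) := by
    by_cases hax : ax k (v, d)
    · simp only [opn, if_pos hax]
      rintro (⟨h1, -⟩ | ⟨-, h2⟩)
      · exact hsel h1.1
      · exact h2.2 rfl
    · simp only [opn, if_neg hax]
      exact fun h => h.2 rfl
  ext e
  constructor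
  · rintro ⟨v', d', rfl, hopn⟩
    have hvd : (v', d') ≠ (v, d) := by
      intro h
      rw [Prod.mk.injEq] at h
      obtain ⟨rfl, rfl⟩ := h
      exact hoff' hopn
    exact ⟨⟨v', d', rfl, (hoff _ hvd).1 hopn⟩,
      fun h => hvd (edgeOf_injective (a₁ := (v', d')) (a₂ := (v, d)) h)⟩
  · rintro ⟨⟨v', d', rfl, hopn⟩, hne⟩
    have hvd : (v', d') ≠ (v, d) := by
      intro h
      rw [Prod.mk.injEq] at h
      obtain ⟨rfl, rfl⟩ := h
      exact hne rfl
    exact ⟨v', d', rfl, (hoff _ hvd).2 hopn⟩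

/-- **Selector off: pivotality of an own coin is pivotality of its edge.** If the selector of the
bundle of `(v, d)` is off in `S`, the own coin `(v, d, 0)` is pivotal for the pulled-back event
`cfg k ⁻¹' Aloc` at `S` iff the edge `edgeOf (v, d)` is pivotal for `Aloc` at `cfg k S`. -/
theorem isPivotal_own_iff_of_selector_notMem (k m : ℕ) (F : Fin m → Quad (Set.univ : Set ℂ)) (η : ℝ)
    (S : Set (Site 2 × Fin 2 × Fin 3)) {v : Site 2} {d : Fin 2}
    (hsel : (tb k (v, d), d, (2 : Fin 3)) ∉ S) :
    IsPivotal ((cfg k) ⁻¹' Aloc m F η) (v, d, (0 : Fin 3)) S ↔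
      IsPivotal (Aloc m F η) (edgeOf (v, d)) (cfg k S) := by
  rw [IsPivotal, IsPivotal, Set.mem_preimage, Set.mem_preimage,
    cfg_insert_own_of_selector_notMem k S hsel, cfg_sdiff_own_of_selector_notMem k S hsel]

/-! ## The chain of own-coin flips -/

/-- Discrete intermediate value step along a chain. -/
private theorem exists_step_of_chain (p : ℕ → Prop) :
    ∀ n : ℕ, ¬ p 0 → p n → ∃ j, j < n ∧ ¬ p j ∧ p (j + 1)
  | 0, h0, hn => absurd hn h0
  | n + 1, h0, hn => by
      by_cases h : p n
      · obtain ⟨j, hj, hpj⟩ := exists_step_of_chain p n h0 h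
        exact ⟨j, Nat.lt_succ_of_lt hj, hpj⟩
      · exact ⟨n, n.lt_succ_self, h, hn⟩

/-- **A pivotal selector forces a pivotal own coin along the chain** (registered sub-goal
`exists_isPivotal_own_of_isPivotal_selector` of `stub_slopeBounds`).  If the selector `(t, d, 2)`
is pivotal for the pulled-back localised crossing event at the coin sample `S`, then for some
`j < k` the own coin of the sub-edge `(w j, d)` is pivotal at the sample obtained from `S` by
switching the selector and all own coins of the bundle off and the own coins of the sub-edges
`(w l, d)`, `l < j`, back on. -/
theorem exists_isPivotal_own_of_isPivotal_selector :
    ∀ (k m : ℕ) (F : Fin m → Quad (Set.univ : Set ℂ)) (η : ℝ) (t : Site 2) (d : Fin 2) (w : ℕ → Site 2), (∀ j, j < k → ax k (w j, d) ∧ tb k (w j, d) = t) → (∀ v : Site 2, ax k (v, d) → tb k (v, d) = t → ∃ j, j < k ∧ v = w j) → (∀ j j', j < k → j' < k → w j = w j' → j = j') → ∀ S : Set (Site 2 × Fin 2 × Fin 3), IsPivotal ((cfg k) ⁻¹' Aloc m F η) (t, d, (2 : Fin 3)) S → ∃ j, j < k ∧ IsPivotal ((cfg k) ⁻¹' Aloc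 m F η) (w j, d, (0 : Fin 3)) (S \ ↑(insert (t, d, (2 : Fin 3)) ((Finset.range k).image fun l => (w l, d, (0 : Fin 3)))) ∪ ↑((Finset.range j).image fun l => (w l, d, (0 : Fin 3)))) := by
  intro k m F η t d w hw₁ hw₂ hw₃ S hS
  classical
  set own : ℕ → Site 2 × Fin 2 × Fin 3 := fun l => (w l, d, (0 : Fin 3)) with hown
  set O : Finset (Site 2 × Fin 2 × Fin 3) := (Finset.range k).image own with hO
  set T : Finset (Site 2 × Fin 2 × Fin 3) := insert (t, d, (2 : Fin 3)) O with hT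
  set SJ : Finset (Site 2 × Fin 2 × Fin 3) → Set (Site 2 × Fin 2 × Fin 3) :=
    fun J => S \ ↑T ∪ ↑J with hSJ
  set f : Finset (Site 2 × Fin 2 × Fin 3) → Prop := fun J => cfg k (SJ J) ∈ Aloc m F η with hf
  -- membership bookkeeping
  have hown_inj : ∀ j j', j < k → j' < k → own j = own j' → j = j' := fun j j' hj hj' h =>
    hw₃ j j' hj hj' (by simpa [hown] using h)
  have hmemO : ∀ {j}, j < k → own j ∈ O := fun hj =>
    Finset.mem_image.2 ⟨_, Finset.mem_range.2 hj, rfl⟩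
  have hO2 : ∀ x ∈ O, x.2.2 = 0 := by
    intro x hx
    obtain ⟨l, -, rfl⟩ := Finset.mem_image.1 hx
    rfl
  have hiO : ((t, d, (2 : Fin 3)) : Site 2 × Fin 2 × Fin 3) ∉ O := fun h => by
    simpa using hO2 _ h
  have hiT : ((t, d, (2 : Fin 3)) : Site 2 × Fin 2 × Fin 3) ∈ T := Finset.mem_insert_self _ _
  have hOT : O ⊆ T := Finset.subset_insert _ _
  have hselJ : ∀ J, J ⊆ O → ((t, d, (2 : Fin 3)) : Site 2 × Fin 2 × Fin 3) ∉ SJ J := by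
    intro J hJ hx
    rcases hx with ⟨-, hx⟩ | hx
    · exact hx hiT
    · exact hiO (hJ hx)
  -- `f` is increasing along subsets of `O`
  have hmono : ∀ J J', J ⊆ J' → J' ⊆ O → f J → f J' := by
    intro J J' hJJ' hJ'O hfJ
    refine isUpperSet_Aloc m F η ?_ hfJ
    show refinementConfig k (SJ J) ⊆ refinementConfig k (SJ J')
    refine refinementConfig_mono_of_selector_iff
      (Set.union_subset_union_right _ (Finset.coe_subset.2 hJJ')) fun u d'' => ?_
    have h1 : ((u, d'', (2 : Fin 3)) : Site 2 × Fin 2 × Fin 3) ∉ (↑J : Set _) := fun h => by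
      simpa using hO2 _ (hJJ'.trans hJ'O h)
    have h2 : ((u, d'', (2 : Fin 3)) : Site 2 × Fin 2 × Fin 3) ∉ (↑J' : Set _) := fun h => by
      simpa using hO2 _ (hJ'O h)
    simp only [hSJ, Set.mem_union, h1, h2, or_false]
  -- read-out of the sub-edges in `SJ J`
  have hopnJ : ∀ J, J ⊆ O → ∀ j, j < k → (opn k (SJ J) (w j, d) ↔ own j ∈ J) := by
    intro J hJ j hj
    rw [opn_subEdge k (hw₁ j hj)]
    have hs := hselJ J hJ
    have ho : own j ∈ SJ J ↔ own j ∈ J := by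
      constructor
      · rintro (⟨-, h⟩ | h)
        · exact absurd (Finset.mem_coe.2 (hOT (hmemO hj))) h
        · exact h
      · exact fun h => Or.inr h
    rw [← ho]
    constructor
    · rintro (⟨h, -⟩ | ⟨-, h⟩)
      · exact absurd h hs
      · exact h
    · exact fun h => Or.inr ⟨hs, h⟩
  -- closing the selector
  have hsdiff : S \ {((t, d, (2 : Fin 3)) : Site 2 × Fin 2 × Fin 3)} = SJ (O.filter (· ∈ S)) := by
    ext x
    simp only [hSJ, hT, Set.mem_sdiff, Set.mem_singleton_iff, Set.mem_union, Finset.coe_insert,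
      Set.mem_insert_iff, Finset.mem_coe, Finset.mem_filter, not_or]
    constructor
    · rintro ⟨hxS, hxi⟩
      by_cases hxO : x ∈ O
      · exact Or.inr ⟨hxO, hxS⟩
      · exact Or.inl ⟨hxS, hxi, hxO⟩
    · rintro (⟨hxS, hxi, -⟩ | ⟨hxO, hxS⟩)
      · exact ⟨hxS, hxi⟩
      · exact ⟨hxS, fun h => hiO (h ▸ hxO)⟩
  -- opening the selector
  have hins : cfg k (insert (t, d, (2 : Fin 3)) S) =
      cfg k (SJ (if (t, d, (1 : Fin 3)) ∈ S then O else ∅)) := by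
    have hJO : (if (t, d, (1 : Fin 3)) ∈ S then O else ∅) ⊆ O := by
      split_ifs
      · exact le_rfl
      · exact Finset.empty_subset _
    refine cfg_congr_bundle k hw₂ (fun x hxi hxo => ?_) (fun j hj => ?_)
    · have hxO : x ∉ O := fun h => by
        obtain ⟨l, hl, rfl⟩ := Finset.mem_image.1 h
        exact hxo l (Finset.mem_range.1 hl) rfl
      have hxT : x ∉ (↑T : Set (Site 2 × Fin 2 × Fin 3)) := by
        simp only [hT, Finset.coe_insert, Set.mem_insert_iff, Finset.mem_coe, not_or]
        exact ⟨hxi, hxO⟩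
      have hxJ : x ∉ (↑(if (t, d, (1 : Fin 3)) ∈ S then O else ∅) : Set (Site 2 × Fin 2 × Fin 3)) :=
        fun h => hxO (hJO h)
      simp only [Set.mem_insert_iff, hxi, false_or, hSJ, Set.mem_union, Set.mem_sdiff, hxT,
        not_false_eq_true, and_true, hxJ, or_false]
    · rw [hopnJ _ hJO j hj, opn_subEdge k (hw₁ j hj)]
      simp only [Set.mem_insert_iff, true_or, true_and, not_true_eq_false, false_and, or_false]
      split_ifs with h
      · simp only [h, or_true, true_iff]
        exact hmemO hj
      · simp only [h, Finset.notMem_empty, iff_false, not_or]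
        exact ⟨by simp, not_false⟩
  -- the two extreme values of `f`
  have hext : ¬ f ∅ ∧ f O := by
    have hX : Xor (f (if (t, d, (1 : Fin 3)) ∈ S then O else ∅)) (f (O.filter (· ∈ S))) := by
      have h := hS
      rw [IsPivotal, Set.mem_preimage, Set.mem_preimage, hins, hsdiff] at h
      exact h
    have hJ₁O : O.filter (· ∈ S) ⊆ O := Finset.filter_subset _ _
    split_ifs at hX
    · rcases hX with ⟨hO', hJ₁⟩ | ⟨hJ₁, hO'⟩
      · exact ⟨fun h0 => hJ₁ (hmono _ _ (Finset.empty_subset _) hJ₁O h0), hO'⟩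
      · exact absurd (hmono _ _ hJ₁O le_rfl hJ₁) hO'
    · rcases hX with ⟨h0, hJ₁⟩ | ⟨hJ₁, h0⟩
      · exact absurd (hmono _ _ (Finset.empty_subset _) hJ₁O h0) hJ₁
      · exact ⟨h0, hmono _ _ hJ₁O le_rfl hJ₁⟩
  -- the chain `J_n = {own l | l < n}`
  set Jn : ℕ → Finset (Site 2 × Fin 2 × Fin 3) := fun n => (Finset.range n).image own with hJn
  have hJn0 : Jn 0 = ∅ := by simp [hJn]
  have hJsucc : ∀ n, Jn (n + 1) = insert (own n) (Jn n) := fun n => by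
    simp only [hJn, Finset.range_add_one, Finset.image_insert]
  have h0 : ¬ f (Jn 0) := by rw [hJn0]; exact hext.1
  obtain ⟨n, hn, hfn, hfn1⟩ := exists_step_of_chain (fun n => f (Jn n)) k h0 hext.2
  refine ⟨n, hn, Or.inl ⟨?_, ?_⟩⟩
  · show cfg k (insert (own n) (SJ (Jn n))) ∈ Aloc m F η
    have : insert (own n) (SJ (Jn n)) = SJ (Jn (n + 1)) := by
      simp only [hSJ, hJsucc, Finset.coe_insert, Set.union_insert]
    rw [this]
    exact hfn1
  · show cfg k (SJ (Jn n) \ {own n}) ∉ Aloc m F η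
    have hnot : own n ∉ SJ (Jn n) := by
      rintro (⟨-, h⟩ | h)
      · exact h (Finset.mem_coe.2 (hOT (hmemO hn)))
      · obtain ⟨l, hl, hln⟩ := Finset.mem_image.1 h
        have hl' := Finset.mem_range.1 hl
        have := hown_inj l n (hl'.trans hn) hn hln
        omega
    rw [Set.sdiff_singleton_eq_self hnot]
    exact hfn

end Summit.CriticalPhenomena.CardyFormulaZ2.Theorems.CardySelfRefinement

end
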